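import Summits.Ventures.CertifiedArithmetic.LowPrec.DoubleRoundingFMAMatrix
import Summits.Ventures.CertifiedArithmetic.LowPrec.DoubleRoundingStripLaws

/-!
# Window A is never innocuous — the FMA through a wider format (THEOREM N-fma-A, all records)

HONEST FRAMING: certified error envelopes and provably optimal rounding/accumulation schemes for
low-precision formats under stated cost models; every table by two implementations; no hardware
or vendor claims.

`DFma φ ψ` (`DoubleRoundingFMAMatrix.lean`): ONE fused multiply-add of `φ`-data executed in the
wide format `ψ` and converted to `φ` is the correctly rounded FMA of `φ`.  THEOREM D-fma
(`dFma_of_windows`) proves it from the WINDOW CLAUSE (F), one of whose conjuncts is WINDOW A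
EMPTY, `M_φ < 2^P_ψ` (`maxScaled φ < 2^(m_ψ+1)`): no midpoint `μ` of `φ` is so large that half an
ulp of `ψ` at `μ` reaches the quantum of `φ`.  This file proves the CONVERSE OF THAT CONJUNCT for
EVERY pair of format records `φ ⊆ ψ` (`quantum ψ ∣ quantum φ` (`hq`), the finite range of `φ`
inside that of `ψ` (`hM`), `P_φ ≥ 3`, `P_φ < P_ψ`, `bias φ ≥ 1`, `4` a value of `φ`):

* `not_dFma_of_windowA` — if `maxScaled φ ≥ 3·2^(m_ψ+1)` then `¬ DFma φ ψ`;
* `not_dFma_of_windowA_tie` — if `m_φ + 2 ≤ m_ψ` already `maxScaled φ ≥ 3·2^m_ψ` suffices (the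
  tie of the wide format resolves onto the midpoint, [BoldoMelquiond2008] Thm 3);
* `not_dFma_windowA` — both columns as one decidable hypothesis on parameter records, which
  holds on exactly `22` of the `169` named cells (`dFmaWindowA_named_iff`), all of them failing
  cells of `dFma_named_iff` (`dFmaWindowA_cells`): e5m2 / binary8p3 / binary8p3f → binary32,
  every FP8 → binary16 / bfloat16 with more digits, binary16 / bfloat16 → binary32, e3m2 → e4m3,
  …;
* `not_dFma_binary64_of_range` — THROUGH binary64: every record `φ ⊆ binary64` with
  `3 ≤ P_φ ≤ 51` and `maxScaled φ ≥ 3·2^52` has `¬ DFma φ Binary64` (bfloat16, binary32, and any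
  record with their exponent range), complementing `dFma_via_binary64` (`M_φ < 2^53`: every
  FP4 / FP6 / FP8 record and binary16).

THE WITNESS (`exists_windowA_data`).  `a = 3`, `b = (2^m - 1)·2^k` quanta, `c = 1` quantum:
`a·b = 3(2^m - 1)·2^k = (2t+1)·2^k` quanta with `t = 3·2^(m-1) - 2` EVEN and `2^m ≤ t < 2^(m+1)`,
so `a·b` IS the midpoint `μ` above the even value `t·2^(k+1)` quanta of `φ`, and
`x = μ + quantum φ`.
At `k = m_ψ + 1 - m` the spacing of `ψ` at `μ` is `4` quanta of `φ`, so `fl_ψ x = μ`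
(`DoubleRoundingProductStrip.toRat_roundNE_wide_gmid`), `fl_φ μ = t·2^(k+1)` (tie to even) while
`fl_φ x = (t+1)·2^(k+1)`: `roundNE_roundNE_ne_gmid`.  At `k = m_ψ - m` the spacing is `2` quanta,
`x` is a tie of `ψ` and `μ` is its even side
(`DoubleRoundingGmidBelow.roundNE_roundNE_ne_gmid_tie`).
The range needed is `(t+1)·2^(k+1) ≤ 3·2^(m+k) ≤ maxScaled φ`.

So, record-generically, the window-A conjunct of (F) is necessary up to the factor `3`: pairs
with `2^(m_ψ+1) ≤ M_φ < 3·2^(m_ψ+1)` (resp. `< 3·2^m_ψ` in the tie column), or with `P_φ = 2`,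
are not decided by this file (among the named cells: e2m3 → binary8p5, `32 ≤ 60 < 96`, and the
e2m1 row — all failing, by the witnesses of `DoubleRoundingFMAMatrix.lean`).  PLACEMENT:
[HighamPranesh2019, p. C589] asserts that `chop(a + b*c)` computed in binary64 "will then be
correctly rounded to the target precision" for targets "single or less"; by
`dFma_via_binary64` this holds for the eleven named target records with `M < 2^53` (and, by
`dFma_of_windows`, for every record with `M < 2^53`, `P ≤ 17` and the grid conditions of (F)),
and by `not_dFma_binary64_of_range` it fails for every target record with `3·2^52 ≤ M` and
`3 ≤ P ≤ 51` — bfloat16 and binary32 included (previously two kernel witnesses,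
`DoubleRoundingFMAMatrix.lean` §5; now a law over records).  Double-rounding slips forced onto
midpoints: [MartinDorelMelquiondMuller2013] Property 2.1; innocuous precisions for `+ - × ÷ √`:
[Figueroa1995] §3, [Roux2014] §2.  We found no statement of the window-A law in the literature
searched (queries in the cell's notes).
Implementation A: `code/enum/fma_windowA_law.py` → `DOUBLE-ROUNDING-FMA.md` §7,
`certs/enum/DOUBLE-ROUNDING-FMA-WINDOWA.json`.  No hardware or vendor claims.
-/

namespace Summit.Ventures.CertifiedArithmetic

open Literature.ComputerArithmetic.FloatingPoint
open Literature.ComputerArithmetic.FloatingPoint.Format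
open Literature.ComputerArithmetic.FloatingPoint.MiniFloat

/-! ## §1 The witness data -/

/-- THE WINDOW-A DATA of a record `φ` with `m ≥ 2`, `bias ≥ 1`, `4` a value and
`3·2^(m+k) ≤ maxScaled`: `a = 3`, `b = (2^m - 1)·2^k` quanta, `c = 1` quantum have
`a·b + c = (2t+1)·2^k · quantum + quantum` with `t = 3·2^(m-1) - 2` even, `2^m ≤ t < 2^(m+1)`,
`(t+1)·2^(k+1) ≤ maxScaled`. [this packet] -/
theorem exists_windowA_data {φ : Format} (h2 : 2 ≤ φ.manBits) (hb : 1 ≤ φ.bias)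
    (hR : 2 ^ (φ.manBits + φ.bias + 1) ≤ φ.maxScaled) {k : ℕ}
    (hk : 3 * 2 ^ (φ.manBits + k) ≤ φ.maxScaled) :
    ∃ t : ℕ, Even t ∧ 2 ^ φ.manBits ≤ t ∧ t < 2 ^ (φ.manBits + 1) ∧
      (t + 1) * 2 ^ (k + 1) ≤ φ.maxScaled ∧ ∃ a b c : MiniFloat φ,
        a.toRat * b.toRat + c.toRat = (((2 * t + 1) * 2 ^ k : ℕ) : ℚ) * φ.quantum + φ.quantum := by
  obtain ⟨j, hj⟩ := Nat.exists_eq_add_of_le h2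
  obtain ⟨w, hw⟩ := Nat.exists_eq_add_of_le' (Nat.one_le_two_pow (n := j))
  have h4 : 2 ^ φ.manBits = 4 * (w + 1) := by rw [hj, pow_add, hw]; ring
  have hunit := two_pow_mul_quantum_eq_one hb
  -- range bookkeeping: `(t+1)·2^(k+1) = (12w+10)·2^k ≤ (12w+12)·2^k = 3·2^(m+k)`
  have h3mk : 3 * 2 ^ (φ.manBits + k) = (12 * w + 12) * 2 ^ k := by rw [pow_add, h4]; ring
  have hu : (6 * w + 4 + 1) * 2 ^ (k + 1) ≤ φ.maxScaled := by
    refine le_trans ?_ hk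
    rw [h3mk, pow_succ]
    calc (6 * w + 4 + 1) * (2 ^ k * 2) = (12 * w + 10) * 2 ^ k := by ring
      _ ≤ (12 * w + 12) * 2 ^ k := Nat.mul_le_mul_right _ (by omega)
  -- the data
  have h3lt : 3 < 2 ^ (φ.manBits + 1) := by rw [pow_succ, h4]; omega
  have h3le : 3 * 2 ^ (φ.manBits + (φ.bias - 1)) ≤ φ.maxScaled := by
    refine le_trans ?_ hR
    have e : 2 ^ (φ.manBits + φ.bias + 1) = 4 * 2 ^ (φ.manBits + (φ.bias - 1)) := by
      rw [show φ.manBits + φ.bias + 1 = φ.manBits + (φ.bias - 1) + 2 by omega, pow_add]; ring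
    rw [e]
    exact Nat.mul_le_mul_right _ (by norm_num)
  obtain ⟨a, ha⟩ := exists_toRat_eq_natMul (representable_mul_pow h3lt h3le)
  have hblt : 4 * w + 3 < 2 ^ (φ.manBits + 1) := by rw [pow_succ, h4]; omega
  have hble : (4 * w + 3) * 2 ^ k ≤ φ.maxScaled := by
    refine le_trans ?_ hk
    rw [h3mk]
    exact Nat.mul_le_mul_right _ (by omega)
  obtain ⟨b, hb2⟩ := exists_toRat_eq_natMul (representable_mul_pow hblt hble)
  have h1le : 1 ≤ φ.maxScaled := le_trans (Nat.one_le_two_pow) hR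
  obtain ⟨c, hc⟩ := exists_toRat_eq_natMul
    (representable_of_lt_pow (φ := φ) (n := 1) (by omega) h1le)
  refine ⟨6 * w + 4, ⟨3 * w + 2, by ring⟩, by omega, by rw [pow_succ, h4]; omega, hu,
    a, b, c, ?_⟩
  rw [ha, hb2, hc]
  push_cast
  linear_combination ((12 * (w : ℚ) + 9) * 2 ^ k * φ.quantum) * hunit

/-! ## §2 The window-A law -/

/-- THEOREM N-fma-A (strict column).  For records `φ ⊆ ψ` (`hq`, `hM`) with `2 ≤ m_φ < m_ψ`,
`bias φ ≥ 1`, `4` a value of `φ` and `3·2^(m_ψ+1) ≤ maxScaled φ`: `¬ DFma φ ψ` — at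
`k = m_ψ + 1 - m_φ` the datum `x = a·b + c` of `exists_windowA_data` lies one quantum of `φ`
above the midpoint `a·b`, a quarter of the spacing of `ψ` there. [this packet] -/
theorem not_dFma_of_windowA {φ ψ : Format} (hq : ψ.qexp ≤ φ.qexp)
    (hM : φ.maxScaled * 2 ^ (φ.qexp - ψ.qexp).toNat ≤ ψ.maxScaled) (h2 : 2 ≤ φ.manBits)
    (hP : φ.manBits < ψ.manBits) (hb : 1 ≤ φ.bias)
    (hR : 2 ^ (φ.manBits + φ.bias + 1) ≤ φ.maxScaled)
    (hA : 3 * 2 ^ (ψ.manBits + 1) ≤ φ.maxScaled) : ¬ DFma φ ψ := by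
  obtain ⟨k, hk⟩ : ∃ k, ψ.manBits + 1 = φ.manBits + k := ⟨ψ.manBits + 1 - φ.manBits, by omega⟩
  rw [hk] at hA
  obtain ⟨t, ht, htlo, hthi, hu, a, b, c, habc⟩ := exists_windowA_data h2 hb hR hA
  set d := (φ.qexp - ψ.qexp).toNat with hd
  have hk' : ψ.manBits ≤ φ.manBits + k + d := by omega
  have hδ0 : 0 < φ.quantum := φ.quantum_pos
  have hX : (0 : ℚ) < 2 ^ d * ψ.quantum := by have := ψ.quantum_pos; positivity
  have hδψ : 2 * φ.quantum < 2 ^ (φ.manBits + k + d + 1 - ψ.manBits) * ψ.quantum := by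
    rw [show φ.manBits + k + d + 1 - ψ.manBits = d + 2 by omega]
    calc 2 * φ.quantum = 2 * (2 ^ d * ψ.quantum) := by rw [quantum_eq_two_pow_mul hq]
      _ < 4 * (2 ^ d * ψ.quantum) := by linarith
      _ = 2 ^ (d + 2) * ψ.quantum := by rw [pow_add]; ring
  intro h
  have h' := h a b c
  rw [habc] at h'
  exact roundNE_roundNE_ne_gmid hq hM (by omega) hP ht htlo hthi hu hk' hδ0 hδψ h'

/-- THEOREM N-fma-A (tie column).  For records `φ ⊆ ψ` with `m_φ ≥ 2`, `m_φ + 2 ≤ m_ψ`,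
`bias φ ≥ 1`, `4` a value and `3·2^m_ψ ≤ maxScaled φ`: `¬ DFma φ ψ` — at `k = m_ψ - m_φ` the
quantum of `φ` is exactly half the spacing of `ψ` at the midpoint `a·b`, which is the even
candidate of the tie. [cite: BoldoMelquiond2008, Thm 3] -/
theorem not_dFma_of_windowA_tie {φ ψ : Format} (hq : ψ.qexp ≤ φ.qexp)
    (hM : φ.maxScaled * 2 ^ (φ.qexp - ψ.qexp).toNat ≤ ψ.maxScaled) (h2 : 2 ≤ φ.manBits)
    (hP2 : φ.manBits + 2 ≤ ψ.manBits) (hb : 1 ≤ φ.bias)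
    (hR : 2 ^ (φ.manBits + φ.bias + 1) ≤ φ.maxScaled)
    (hA : 3 * 2 ^ ψ.manBits ≤ φ.maxScaled) : ¬ DFma φ ψ := by
  obtain ⟨k, hk⟩ : ∃ k, ψ.manBits = φ.manBits + k := ⟨ψ.manBits - φ.manBits, by omega⟩
  rw [hk] at hA
  obtain ⟨t, ht, htlo, hthi, hu, a, b, c, habc⟩ := exists_windowA_data h2 hb hR hA
  set d := (φ.qexp - ψ.qexp).toNat with hd
  have hk' : ψ.manBits ≤ φ.manBits + k + d := by omega
  have hδψ : 2 * φ.quantum = 2 ^ (φ.manBits + k + d + 1 - ψ.manBits) * ψ.quantum := by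
    rw [show φ.manBits + k + d + 1 - ψ.manBits = d + 1 by omega, pow_succ,
      quantum_eq_two_pow_mul hq]
    ring
  intro h
  have h' := h a b c
  rw [habc] at h'
  exact roundNE_roundNE_ne_gmid_tie hq hM (by omega) hP2 ht htlo hthi hu hk' hδψ h'

/-- THEOREM N-fma-A, both columns as ONE hypothesis on parameter records: grids and ranges
nested, `P_φ ≥ 3`, `bias φ ≥ 1`, `4` a value, and window A reached — `3·2^(m_ψ+1) ≤ M_φ` with
`m_φ < m_ψ`, or `3·2^m_ψ ≤ M_φ` with `m_φ + 2 ≤ m_ψ`.  (A decidable conjunction: on records it is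
ONE `decide`; implementation A evaluates the same test.) [this packet] -/
theorem not_dFma_windowA {φ ψ : Format}
    (h : ψ.qexp ≤ φ.qexp ∧ φ.maxScaled * 2 ^ (φ.qexp - ψ.qexp).toNat ≤ ψ.maxScaled ∧
      2 ≤ φ.manBits ∧ 1 ≤ φ.bias ∧ 2 ^ (φ.manBits + φ.bias + 1) ≤ φ.maxScaled ∧
      (φ.manBits < ψ.manBits ∧ 3 * 2 ^ (ψ.manBits + 1) ≤ φ.maxScaled ∨
        φ.manBits + 2 ≤ ψ.manBits ∧ 3 * 2 ^ ψ.manBits ≤ φ.maxScaled)) : ¬ DFma φ ψ := by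
  obtain ⟨hq, hM, h2, hb, hR, hA⟩ := h
  rcases hA with ⟨hP, hA⟩ | ⟨hP2, hA⟩
  · exact not_dFma_of_windowA hq hM h2 hP hb hR hA
  · exact not_dFma_of_windowA_tie hq hM h2 hP2 hb hR hA

/-! ## §3 The named records -/

/-- ON THE NAMED `13 × 13` MATRIX the window-A hypothesis holds on exactly these `22` cells (`21`
by the strict column; e3m2 → bfloat16, `384 ≤ 448 < 768`, by the tie column only).  The other
`18` failing embedded cells of `dFma_named_iff` have `P_X = 2` (the e2m1 row, `8`), equal
precisions (`7`), or slip by a product finer than the quantum (e2m3 → binary8p5 / bfloat16,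
binary8p5 → binary16).  Implementation A tabulates the same `22`. [this packet] -/
theorem dFmaWindowA_named_iff : ∀ X ∈ namedFormats, ∀ Y ∈ namedFormats,
    (Y.qexp ≤ X.qexp ∧ X.maxScaled * 2 ^ (X.qexp - Y.qexp).toNat ≤ Y.maxScaled ∧
      2 ≤ X.manBits ∧ 1 ≤ X.bias ∧ 2 ^ (X.manBits + X.bias + 1) ≤ X.maxScaled ∧
      (X.manBits < Y.manBits ∧ 3 * 2 ^ (Y.manBits + 1) ≤ X.maxScaled ∨
        X.manBits + 2 ≤ Y.manBits ∧ 3 * 2 ^ Y.manBits ≤ X.maxScaled)) ↔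
    (X, Y) ∈ [(E3M2, E4M3), (E3M2, Binary8p4), (E3M2, Binary8p4F), (E3M2, BFloat16),
      (E4M3, Binary16), (E4M3, BFloat16), (E5M2, Binary16), (E5M2, BFloat16), (E5M2, Binary32),
      (Binary8p3, Binary16), (Binary8p3, BFloat16), (Binary8p3, Binary32), (Binary8p4, Binary16),
      (Binary8p4, BFloat16), (Binary8p5, BFloat16), (Binary8p3F, Binary16), (Binary8p3F, BFloat16),
      (Binary8p3F, Binary32), (Binary8p4F, Binary16), (Binary8p4F, BFloat16), (Binary16, Binary32),
      (BFloat16, Binary32)] := by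
  decide +kernel

/-- THE `22` WINDOW-A CELLS FAIL BY THE LAW (and are failing cells of the matrix,
`∉ dFmaPairs`): among them e5m2, binary8p3, binary8p3f → binary32 (the precision-3 FP8 formats
reach window A of binary32: `maxScaled ≥ 3·2^24`), every FP8 → binary16 / bfloat16 with more
digits, binary16 / bfloat16 → binary32, e3m2 → e4m3 — each now an instance of one record-generic
theorem rather than a searched witness. [this packet] -/
theorem dFmaWindowA_cells : ∀ p ∈ [(E3M2, E4M3), (E3M2, Binary8p4), (E3M2, Binary8p4F),
    (E3M2, BFloat16), (E4M3, Binary16), (E4M3, BFloat16), (E5M2, Binary16), (E5M2, BFloat16),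
    (E5M2, Binary32), (Binary8p3, Binary16), (Binary8p3, BFloat16), (Binary8p3, Binary32),
    (Binary8p4, Binary16), (Binary8p4, BFloat16), (Binary8p5, BFloat16), (Binary8p3F, Binary16),
    (Binary8p3F, BFloat16), (Binary8p3F, Binary32), (Binary8p4F, Binary16), (Binary8p4F, BFloat16),
    (Binary16, Binary32), (BFloat16, Binary32)], p ∉ dFmaPairs ∧ ¬ DFma p.1 p.2 := by
  intro p hp
  simp only [List.mem_cons, List.not_mem_nil, or_false] at hp
  rcases hp with rfl | rfl | rfl | rfl | rfl | rfl | rfl | rfl | rfl | rfl | rfl | rfl | rfl |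
    rfl | rfl | rfl | rfl | rfl | rfl | rfl | rfl | rfl
  all_goals exact ⟨by decide +kernel, not_dFma_windowA (by decide +kernel)⟩

/-! ## §4 Through binary64 -/

/-- THROUGH binary64 — THE RANGE LAW.  Every record `φ` whose grid and range lie inside binary64's
(`qexp φ ≥ -1074`, `maxRat φ ≤ maxRat binary64` in the aligned form `hM`), with `3 ≤ P_φ ≤ 51`,
`bias ≥ 1`, `4` a value and `maxScaled φ ≥ 3·2^52`, has a triple of data whose binary64 FMA,
converted back, is NOT the correctly rounded FMA of `φ`: `¬ DFma φ Binary64`.  With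
`dFma_via_binary64` / `dFma_of_windows` (`maxScaled φ < 2^53` and the grid conditions of (F)
suffice for `P_φ ≤ 17`): the recipe "FMA in binary64, then round" [HighamPranesh2019, p. C589]
is exact for every FP4 / FP6 / FP8 record and binary16, and inexact for every record reaching
`3·2^52` quanta. [this packet] -/
theorem not_dFma_binary64_of_range {φ : Format} (hq : Binary64.qexp ≤ φ.qexp)
    (hM : φ.maxScaled * 2 ^ (φ.qexp - Binary64.qexp).toNat ≤ Binary64.maxScaled)
    (h2 : 2 ≤ φ.manBits) (hP : φ.manBits ≤ 50) (hb : 1 ≤ φ.bias)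
    (hR : 2 ^ (φ.manBits + φ.bias + 1) ≤ φ.maxScaled) (hA : 3 * 2 ^ 52 ≤ φ.maxScaled) :
    ¬ DFma φ Binary64 :=
  not_dFma_of_windowA_tie hq hM h2 (show φ.manBits + 2 ≤ 52 by omega) hb hR hA

/-- bfloat16 and binary32 through binary64, now as instances of the range law (the kernel
witnesses `not_dFma_bfloat16_binary64`, `not_dFma_binary32_binary64` of
`DoubleRoundingFMAMatrix.lean` §5 are other triples of the same cells). -/
example : ¬ DFma BFloat16 Binary64 ∧ ¬ DFma Binary32 Binary64 :=
  ⟨not_dFma_binary64_of_range (by decide) (by decide +kernel) (by decide) (by decide) (by decide)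
      (by decide +kernel) (by decide +kernel),
    not_dFma_binary64_of_range (by decide) (by decide +kernel) (by decide) (by decide) (by decide)
      (by decide +kernel) (by decide +kernel)⟩

/-- … while binary16 stays on the exact side: `maxScaled = 65504·2^24 < 2^53`
(`dFma_via_binary64`), below window A of binary64. -/
example : DFma Binary16 Binary64 ∧ Binary16.maxScaled < 2 ^ 53 ∧
    ¬ 3 * 2 ^ 52 ≤ Binary16.maxScaled :=
  ⟨dFma_via_binary64 Binary16 (by simp), by decide +kernel, by decide +kernel⟩

end Summit.Ventures.CertifiedArithmetic
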